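import Mathlib

/-!
# Flat fibres: Bessel's inequality for the `|K| + 1` line partitions of `M₂(K)`
# (crux `LevelGradedCohnUmans.GradedDesignFamily`, stmt-MatrixMultiplication-7610; negative side,
# line `quadratic-extension-level-one-cell`, stub `gl2Flat_fibre_sq_sum_le`)

Let `K` be a finite field, `Q := |K|`, `V := M₂(K)` (so `|V| = Q⁴`), and let
`r none := (0, 1)`, `r (some t) := (1, t)` be the `Q + 1` standard representatives of the lines
of `K²`.  For `Γ ⊆ V` put `n_i(w) := #{x ∈ Γ : x · r i = w}`.  Then

* `gl2Flat_fibre_sq_sum_le` — `Q · ∑_i ∑_w n_i(w)² ≤ Q³ |Γ| + |Γ|²`.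

Proof.  (1) Key geometry (`gl2Flat_fibre_sq_sum_le_pair_bijective`): for non-proportional
`u, v ∈ K²` the map `x ↦ (x u, x v) : V → K² × K²` is a bijection (a `2 × 2` matrix is
determined by its action on a basis; injective plus equal cardinalities `Q⁴`).  Hence every
fibre `{x : x u = w}` has `Q²` elements and two distinct partitions `x ↦ x · r i`, `x ↦ x · r j`
are independent ("mutually orthogonal").  (2) Bessel, written without division: with
`H(x) := ∑_i n_i(x · r i)` and `T := ∑_i ∑_w n_i(w)²` one computes, by reindexing along the
bijections of (1) and summing fibrewise over `Γ`,
`∑_x H = (Q + 1) Q² |Γ|`, `∑_{x ∈ Γ} H = T`, `∑_x H² = Q² T + (Q + 1) Q |Γ|²`,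
and then `0 ≤ (Q H(x) - |Γ| - Q³)²` summed over `Γ`, together with
`∑_{x ∈ Γ} (Q H(x) - |Γ|)² ≤ ∑_x (Q H(x) - |Γ|)² = Q⁴ T - Q³ |Γ|²`, gives
`Q⁴ T ≤ Q⁶ |Γ| + Q³ |Γ|²`; divide by `Q³`.  (This is exactly Bessel's inequality in `ℝ^V` for
the indicator function of `Γ` against the orthogonal family `{1} ∪ {n_i(x · r i) - |Γ|/Q²}`.)

This is ingredient (iii) of the flat-size lemma of the line's negative programme (the bound on
`∑_{x, y ∈ Γ} #{u : x u = y u}` for a subset `Γ` of `GL₂(K)`).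

Sorry-free; axioms `propext`, `Classical.choice`, `Quot.sound`.
-/

set_option linter.dupNamespace false

open scoped BigOperators

namespace Summit.MatrixMultiplication.MatrixMultiplication.Theorems.GradedDesignFamily.Negative

/-- Key geometry: if `u, v : K²` are not proportional (the `2 × 2` determinant
`u 0 * v 1 - u 1 * v 0` is nonzero), then a `2 × 2` matrix is determined by its action on `u`
and `v`, and by counting the map `x ↦ (x u, x v)` is a bijection `M₂(K) → K² × K²`.
[folklore] -/
theorem gl2Flat_fibre_sq_sum_le_pair_bijective {K : Type} [Field K] [Fintype K]
    [DecidableEq K] (u v : Fin 2 → K) (h : u 0 * v 1 - u 1 * v 0 ≠ 0) :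
    Function.Bijective fun x : Matrix (Fin 2) (Fin 2) K => (x.mulVec u, x.mulVec v) := by
  rw [Fintype.bijective_iff_injective_and_card]
  refine ⟨fun x y hxy => ?_, ?_⟩
  · simp only [Prod.mk.injEq] at hxy
    obtain ⟨hu, hv⟩ := hxy
    ext a b
    have h1 := congrFun hu a
    have h2 := congrFun hv a
    simp only [Matrix.mulVec, dotProduct, Fin.sum_univ_two] at h1 h2
    have e0 : (x a 0 - y a 0) * (u 0 * v 1 - u 1 * v 0) = 0 := by
      linear_combination (v 1) * h1 - (u 1) * h2
    have e1 : (x a 1 - y a 1) * (u 0 * v 1 - u 1 * v 0) = 0 := by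
      linear_combination (u 0) * h2 - (v 0) * h1
    have f0 : x a 0 = y a 0 := sub_eq_zero.mp ((mul_eq_zero.mp e0).resolve_right h)
    have f1 : x a 1 = y a 1 := sub_eq_zero.mp ((mul_eq_zero.mp e1).resolve_right h)
    fin_cases b
    · exact f0
    · exact f1
  · rw [Fintype.card_prod]
    change Fintype.card (Fin 2 → Fin 2 → K) = _
    rw [Fintype.card_fun, Fintype.card_fun, Fintype.card_fin]
    ring

/-- Reindexing a sum over `M₂(K)` by the bijection `x ↦ (x u, x v)` of
`gl2Flat_fibre_sq_sum_le_pair_bijective`. [folklore] -/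
theorem gl2Flat_fibre_sq_sum_le_sum_pair {K : Type} [Field K] [Fintype K]
    [DecidableEq K] (u v : Fin 2 → K) (h : u 0 * v 1 - u 1 * v 0 ≠ 0)
    (φ : (Fin 2 → K) × (Fin 2 → K) → ℝ) :
    ∑ x : Matrix (Fin 2) (Fin 2) K, φ (x.mulVec u, x.mulVec v) = ∑ p, φ p :=
  (gl2Flat_fibre_sq_sum_le_pair_bijective u v h).sum_comp φ

/-- Every fibre of `x ↦ x u` (`u ≠ 0`, witnessed by a non-proportional `v`) has `|K|²` elements:
`∑_x φ (x u) = |K|² ∑_w φ w`. [folklore] -/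
theorem gl2Flat_fibre_sq_sum_le_sum_single {K : Type} [Field K] [Fintype K]
    [DecidableEq K] (u v : Fin 2 → K) (h : u 0 * v 1 - u 1 * v 0 ≠ 0)
    (φ : (Fin 2 → K) → ℝ) :
    ∑ x : Matrix (Fin 2) (Fin 2) K, φ (x.mulVec u) = (Fintype.card K : ℝ) ^ 2 * ∑ w, φ w := by
  rw [gl2Flat_fibre_sq_sum_le_sum_pair u v h (fun p => φ p.1), Fintype.sum_prod_type,
    Finset.mul_sum]
  refine Finset.sum_congr rfl fun w _ => ?_
  dsimp only
  rw [Finset.sum_const, Finset.card_univ, nsmul_eq_mul, Fintype.card_fun, Fintype.card_fin]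
  push_cast
  ring

/-- The `|K| + 1` representatives `r none = (0, 1)`, `r (some t) = (1, t)` of the lines of `K²`
are pairwise non-proportional. [folklore] -/
theorem gl2Flat_fibre_sq_sum_le_rep_det {K : Type} [Field K] {i j : Option K}
    (hij : i ≠ j) :
    (i.elim ![0, 1] fun t => ![1, t]) 0 * (j.elim ![0, 1] fun t => ![1, t]) 1 -
      (i.elim ![0, 1] fun t => ![1, t]) 1 * (j.elim ![0, 1] fun t => ![1, t]) 0 ≠ 0 := by
  cases i with
  | none =>
    cases j with
    | none => exact absurd rfl hij
    | some t => simp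
  | some s =>
    cases j with
    | none => simp
    | some t =>
      have hst : s ≠ t := fun h => hij (by rw [h])
      simpa [sub_eq_zero] using fun h => hst h.symm

/-- **Bessel core, abstract representatives.**  For any family `r : Option K → K²` of pairwise
non-proportional vectors and any `Γ ⊆ M₂(K)`, with `n_i(w) := #{x ∈ Γ : x (r i) = w}`:
`|K| · ∑_i ∑_w n_i(w)² ≤ |K|³ |Γ| + |Γ|²`. [folklore] -/
theorem gl2Flat_fibre_sq_sum_le_main {K : Type} [Field K] [Fintype K] [DecidableEq K]
    (Γ : Finset (Matrix (Fin 2) (Fin 2) K)) (r : Option K → Fin 2 → K)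
    (hr : ∀ i j, i ≠ j → r i 0 * r j 1 - r i 1 * r j 0 ≠ 0) :
    (Fintype.card K : ℝ) *
        ∑ i : Option K, ∑ w : Fin 2 → K,
          ((Γ.filter fun x => x.mulVec (r i) = w).card : ℝ) ^ 2 ≤
      (Fintype.card K : ℝ) ^ 3 * Γ.card + (Γ.card : ℝ) ^ 2 := by
  -- notation: `Q = |K|`, `c = |Γ|`, `N i w = n_i(w)`
  obtain ⟨N, hN⟩ : ∃ N : Option K → (Fin 2 → K) → ℝ,
      ∀ i w, N i w = ((Γ.filter fun x => x.mulVec (r i) = w).card : ℝ) := ⟨_, fun _ _ => rfl⟩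
  simp only [← hN]
  set Q : ℝ := (Fintype.card K : ℝ) with hQ
  set c : ℝ := (Γ.card : ℝ) with hc
  -- every index has a partner
  have hex : ∀ i : Option K, ∃ j, i ≠ j := by
    intro i
    cases i with
    | none => exact ⟨some 0, (Option.some_ne_none 0).symm⟩
    | some t => exact ⟨none, Option.some_ne_none t⟩
  -- (L0) the fibres of `x ↦ x (r i)` partition `Γ`
  have hL0 : ∀ i, ∑ w, N i w = c := by
    intro i
    rw [hc, Finset.card_eq_sum_card_fiberwise (f := fun x => x.mulVec (r i)) (t := Finset.univ)
      (fun x _ => Finset.mem_coe.mpr (Finset.mem_univ _))]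
    push_cast
    exact Finset.sum_congr rfl fun w _ => hN i w
  -- (L1) `∑_x n_i(x r_i) = Q² c`
  have hL1 : ∀ i, ∑ x : Matrix (Fin 2) (Fin 2) K, N i (x.mulVec (r i)) = Q ^ 2 * c := by
    intro i
    obtain ⟨j, hij⟩ := hex i
    rw [gl2Flat_fibre_sq_sum_le_sum_single (r i) (r j) (hr i j hij) (N i), hL0 i]
  -- (L2) `∑_{x ∈ Γ} n_i(x r_i) = ∑_w n_i(w)²`
  have hL2 : ∀ i, ∑ x ∈ Γ, N i (x.mulVec (r i)) = ∑ w, N i w ^ 2 := by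
    intro i
    rw [← Finset.sum_fiberwise' Γ (fun x => x.mulVec (r i)) (N i)]
    refine Finset.sum_congr rfl fun w _ => ?_
    rw [Finset.sum_const, nsmul_eq_mul, sq, hN i w]
  -- (L3) `i ≠ j`: `∑_x n_i(x r_i) n_j(x r_j) = c²` (the two partitions are orthogonal)
  have hL3 : ∀ i j, i ≠ j →
      ∑ x : Matrix (Fin 2) (Fin 2) K, N i (x.mulVec (r i)) * N j (x.mulVec (r j)) = c ^ 2 := by
    intro i j hij
    rw [gl2Flat_fibre_sq_sum_le_sum_pair (r i) (r j) (hr i j hij) (fun p => N i p.1 * N j p.2),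
      Fintype.sum_prod_type]
    dsimp only
    rw [← Finset.sum_mul_sum, hL0 i, hL0 j, sq]
  -- (L4) `∑_x n_i(x r_i)² = Q² ∑_w n_i(w)²`
  have hL4 : ∀ i, ∑ x : Matrix (Fin 2) (Fin 2) K, N i (x.mulVec (r i)) ^ 2 =
      Q ^ 2 * ∑ w, N i w ^ 2 := by
    intro i
    obtain ⟨j, hij⟩ := hex i
    rw [gl2Flat_fibre_sq_sum_le_sum_single (r i) (r j) (hr i j hij) (fun w => N i w ^ 2)]
  -- `H x := ∑_i n_i(x r_i)` and `T := ∑_i ∑_w n_i(w)²`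
  obtain ⟨H, hH⟩ : ∃ H : Matrix (Fin 2) (Fin 2) K → ℝ,
      ∀ x, H x = ∑ i, N i (x.mulVec (r i)) := ⟨_, fun _ => rfl⟩
  set T : ℝ := ∑ i, ∑ w, N i w ^ 2 with hT
  have hcardV : (Fintype.card (Matrix (Fin 2) (Fin 2) K) : ℝ) = Q ^ 4 := by
    rw [hQ, show Fintype.card (Matrix (Fin 2) (Fin 2) K) = Fintype.card (Fin 2 → Fin 2 → K)
      from rfl, Fintype.card_fun, Fintype.card_fun, Fintype.card_fin]
    push_cast
    ring
  have hcardO : (Fintype.card (Option K) : ℝ) = Q + 1 := by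
    rw [Fintype.card_option]; push_cast; rw [hQ]
  -- (G2) `∑_x H x = (Q + 1) Q² c`
  have hG2 : ∑ x, H x = (Q + 1) * (Q ^ 2 * c) := by
    simp only [hH]
    rw [Finset.sum_comm, Finset.sum_congr rfl fun i _ => hL1 i, Finset.sum_const,
      Finset.card_univ, nsmul_eq_mul, hcardO]
  -- (G3) `∑_{x ∈ Γ} H x = T`
  have hG3 : ∑ x ∈ Γ, H x = T := by
    simp only [hH]
    rw [Finset.sum_comm, hT]
    exact Finset.sum_congr rfl fun i _ => hL2 i
  -- (G4) `∑_x (H x)² = Q² T + (Q + 1) Q c²`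
  have hG4 : ∑ x, H x ^ 2 = Q ^ 2 * T + (Q + 1) * (Q * c ^ 2) := by
    calc ∑ x, H x ^ 2 = ∑ x : Matrix (Fin 2) (Fin 2) K,
          ∑ i, ∑ j, N i (x.mulVec (r i)) * N j (x.mulVec (r j)) := by
          refine Finset.sum_congr rfl fun x _ => ?_
          rw [sq, hH, Finset.sum_mul_sum]
      _ = ∑ i, ∑ j, ∑ x : Matrix (Fin 2) (Fin 2) K,
            N i (x.mulVec (r i)) * N j (x.mulVec (r j)) := by
          rw [Finset.sum_comm]
          exact Finset.sum_congr rfl fun i _ => Finset.sum_comm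
      _ = ∑ i : Option K, (Q ^ 2 * ∑ w, N i w ^ 2 + Q * c ^ 2) := by
          refine Finset.sum_congr rfl fun i _ => ?_
          rw [← Finset.add_sum_erase _ _ (Finset.mem_univ i)]
          congr 1
          · rw [← hL4 i]
            exact Finset.sum_congr rfl fun x _ => (sq _).symm
          · rw [Finset.sum_congr rfl fun j hj => hL3 i j (Finset.ne_of_mem_erase hj).symm,
              Finset.sum_const, Finset.card_erase_of_mem (Finset.mem_univ i), Finset.card_univ,
              Fintype.card_option, Nat.add_sub_cancel, nsmul_eq_mul]
      _ = Q ^ 2 * T + (Q + 1) * (Q * c ^ 2) := by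
          rw [Finset.sum_add_distrib, ← Finset.mul_sum, ← hT, Finset.sum_const, Finset.card_univ,
            nsmul_eq_mul, hcardO]
  -- Bessel: `0 ≤ ∑_x (Q H x - c - Q³ [x ∈ Γ])²`, organised as two inequalities
  have hA : ∑ x ∈ Γ, (2 * Q ^ 3 * (Q * H x - c) - Q ^ 6) ≤ ∑ x ∈ Γ, (Q * H x - c) ^ 2 :=
    Finset.sum_le_sum fun x _ => by nlinarith [sq_nonneg (Q * H x - c - Q ^ 3)]
  have hB : ∑ x ∈ Γ, (Q * H x - c) ^ 2 ≤ ∑ x, (Q * H x - c) ^ 2 :=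
    Finset.sum_le_univ_sum_of_nonneg fun x => sq_nonneg _
  have hC : ∑ x ∈ Γ, (2 * Q ^ 3 * (Q * H x - c) - Q ^ 6) =
      2 * Q ^ 4 * T - (2 * Q ^ 3 * c + Q ^ 6) * c := by
    calc ∑ x ∈ Γ, (2 * Q ^ 3 * (Q * H x - c) - Q ^ 6)
        = ∑ x ∈ Γ, (2 * Q ^ 4 * H x - (2 * Q ^ 3 * c + Q ^ 6)) :=
          Finset.sum_congr rfl fun x _ => by ring
      _ = ∑ x ∈ Γ, 2 * Q ^ 4 * H x - ∑ _x ∈ Γ, (2 * Q ^ 3 * c + Q ^ 6) :=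
          Finset.sum_sub_distrib _ _
      _ = 2 * Q ^ 4 * T - (2 * Q ^ 3 * c + Q ^ 6) * c := by
          rw [Finset.sum_const, nsmul_eq_mul, ← hc, ← Finset.mul_sum, hG3]; ring
  have hD : ∑ x, (Q * H x - c) ^ 2 = Q ^ 4 * T - Q ^ 3 * c ^ 2 := by
    calc ∑ x, (Q * H x - c) ^ 2 = ∑ x, (Q ^ 2 * H x ^ 2 - 2 * Q * c * H x + c ^ 2) :=
          Finset.sum_congr rfl fun x _ => by ring
      _ = Q ^ 2 * ∑ x, H x ^ 2 - 2 * Q * c * ∑ x, H x +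
            ∑ _x : Matrix (Fin 2) (Fin 2) K, c ^ 2 := by
          rw [Finset.sum_add_distrib, Finset.sum_sub_distrib, Finset.mul_sum, Finset.mul_sum]
      _ = Q ^ 4 * T - Q ^ 3 * c ^ 2 := by
          rw [hG4, hG2, Finset.sum_const, Finset.card_univ, nsmul_eq_mul, hcardV]
          ring
  have hkey : Q ^ 4 * T ≤ Q ^ 6 * c + Q ^ 3 * c ^ 2 := by linarith
  have hQpos : 0 < Q := by rw [hQ]; exact_mod_cast Fintype.card_pos
  refine le_of_mul_le_mul_left ?_ (pow_pos hQpos 3)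
  calc Q ^ 3 * (Q * T) = Q ^ 4 * T := by ring
    _ ≤ Q ^ 6 * c + Q ^ 3 * c ^ 2 := hkey
    _ = Q ^ 3 * (Q ^ 3 * c + c ^ 2) := by ring

/-- **Bessel core of the flat-size lemma, representative form.**  Let `K` be a finite field with
`Q := |K|`, let `r none := (0, 1)` and `r (some t) := (1, t)` be the `Q + 1` standard
representatives of the lines of `K²`, and for `Γ ⊆ M₂(K)` put
`n_i(w) := #{x ∈ Γ : x · r i = w}`.  Then
`Q · ∑_i ∑_w n_i(w)² ≤ Q³ |Γ| + |Γ|²`, i.e. `∑_i ∑_w n_i(w)² ≤ Q² |Γ| + |Γ|² / Q`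
(Bessel's inequality for the `Q + 1` mutually orthogonal partitions `x ↦ x · r i` of `M₂(K)`
against the indicator function of `Γ`). [folklore] -/
theorem gl2Flat_fibre_sq_sum_le : ∀ {K : Type} [Field K] [Fintype K] [DecidableEq K]
    (Γ : Finset (Matrix (Fin 2) (Fin 2) K)),
    (Fintype.card K : ℝ) *
        ∑ i : Option K, ∑ w : Fin 2 → K,
          ((Γ.filter fun x => x.mulVec (i.elim ![0, 1] fun t => ![1, t]) = w).card : ℝ) ^ 2 ≤
      (Fintype.card K : ℝ) ^ 3 * Γ.card + (Γ.card : ℝ) ^ 2 := by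
  intro K _ _ _ Γ
  exact gl2Flat_fibre_sq_sum_le_main Γ (fun i => i.elim ![0, 1] fun t => ![1, t])
    fun i j hij => gl2Flat_fibre_sq_sum_le_rep_det hij

end Summit.MatrixMultiplication.MatrixMultiplication.Theorems.GradedDesignFamily.Negative
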